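import Literature.MathematicalPhysics.QuantumFieldTheory.OSInfinitesimalBoost
import Literature.MathematicalPhysics.QuantumFieldTheory.OSBoostUniformBound
import Literature.MathematicalPhysics.QuantumFieldTheory.OSTimeTubeRotations
import Literature.MathematicalPhysics.QuantumFieldTheory.OSTimeContinuationProofs
import Literature.MathematicalPhysics.QuantumLattice.SchwartzTranslationCutoff
import Mathlib.Analysis.Calculus.MeanValue
import HarnessLib

/-!
# Lorentz invariance of the OS boundary values from E1: `OS1973_lorentzInvariant_of_timeContinuation_holds`

This file **discharges the named fact (B)**
`Literature.MathematicalPhysics.QuantumFieldTheory.OS1973_lorentzInvariant_of_timeContinuation`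
of `OSTimeContinuation` — Osterwalder–Schrader I (Comm. Math. Phys. 31 (1973)), §4.2 "Lorentz
Covariance and Spectrum Condition": the boundary values of the analytically continued Schwinger
functions are invariant under the restricted Lorentz group, as a consequence of the Euclidean
covariance E1 — for a function `𝔚` which is known only on the **time tube** (continuous there,
holomorphic in the times: OS II (1975), Thm. 4.3), with time-ray boundary value `T` and Euclidean
restriction `𝔖ₙ` on time-ordered test functions. OS derive it from the infinitesimal generators
((4.14)–(4.17)) and "the uniqueness theorem for Laplace and Fourier transforms of distributions";
here the argument is carried out in position space on the time tube:

* spatial isometries `1 ⊕ R` preserve the time tube and act trivially on `𝔚` (E1 at Euclidean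
  points + the identity theorem in the times) and hence on `T` (`OSTimeTubeRotations`);
* for the boosts `B_j(s)`, the infinitesimal rotation invariance at Euclidean points
  (`OSEuclideanRotationGenerator`), smeared in space and continued analytically in the times
  (`OSTimeTubeSmearedRotation`, `OSTimeTubeRotationIdentity`), gives along every temporal ray the
  weak infinitesimal boost identity `∫ 𝔚(x+itη) (X_{0j}F)(x) dx = −it ∫ 𝔚(x+itη) (𝒟F)(x) dx`
  (`OSInfinitesimalBoost`); it is **exponentiated here**
  (`HasTimeRayBoundaryValue.apply_eq_of_boost`) through the regularised pairings
  `g_t(s) = ∫ 𝔚(x+itη) F(B(−s)x) dx`, whose derivative is `it ∫ 𝔚(x+itη) 𝒟(F ∘ B(−s)) dx`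
  (`OSBoostOneParameter`) and is bounded by `t M` uniformly (`OSBoostUniformBound`), so that
  `|g_t(s) − g_t(0)| ≤ t M |s| → 0` while `g_t(s) − g_t(0) → T(F ∘ B(−s)) − T(F)`; compact
  supports are removed by density (`exists_tsupport_subset_inter_closedBall_tendsto`);
* every restricted Lorentz transformation is `(1 ⊕ R₁) B(χ) (1 ⊕ R₂)`
  (`exists_eq_spatialRotation_mul_boost_mul`, `OSLorentzInvariance`).

The hypotheses of OS growth and half-space spectral support in (B) are not needed. With (B)
discharged, the tree's assemblies (`OSTimeContinuation`, `OSTimeTubeUniqueness`,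
`OSTimeContinuationProofs`, `OSWightmanAxiomsAssembly`) make `OS1975_exists_continuation_halfSpace`,
the spectral condition `OS1973_spectralCondition` and `OS1975_exists_wightmanFamily` depend on
(A1) `OS1975_exists_timeContinuation` alone (`…_of_A1` corollaries below).

## References

* K. Osterwalder, R. Schrader, *Axioms for Euclidean Green's functions*, Comm. Math. Phys. 31
  (1973) 83–112, §4.2, (4.14)–(4.17). [OsterwalderSchraderCMP1973]
* K. Osterwalder, R. Schrader, *Axioms for Euclidean Green's functions II*, Comm. Math. Phys. 42
  (1975) 281–305, §IV.2 p. 288 ("The remaining Wightman axioms can be established as in Sections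
  4.2–4.5 of OS I"). [OsterwalderSchraderCMP1975]
-/

noncomputable section

open Filter Complex Set MeasureTheory Metric
open scoped Topology SchwartzMap ContDiff
open Literature.MathematicalPhysics.QuantumLattice

namespace Literature.MathematicalPhysics.QuantumFieldTheory

variable {d n : ℕ} {S : SchwingerFamily (EuclideanSpace ℝ (Fin (d + 1)))}
  {𝔚 : (Fin n → Fin (d + 1) → ℂ) → ℂ} {T : 𝓢((Fin n → SpaceTime d), ℂ) →L[ℂ] ℂ}

/-! ### Exponentiation: boost invariance of the boundary value -/

/-- **Boost invariance of the time-ray boundary value on compactly supported test functions**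
(Osterwalder–Schrader I (1973), §4.2, the exponentiation of `X_{0j} W̃ₙ = 0`): under E1, for `𝔚`
continuous on the time tube, holomorphic in the times, with Euclidean restriction `𝔖ₙ` and
time-ray boundary value `T`, `T(F ∘ B_j(s)⁻¹) = T(F)` for every compactly supported test
function `F` (witness form). Proof: for `t > 0` the regularised pairing
`g_t(r) = ∫ 𝔚(x + itη) F(B(−r)x) dx` has derivative `it ∫ 𝔚(x + itη) 𝒟(F ∘ B(−r))(x) dx`
(differentiation under the integral sign, the chain rule along the generator, and the weak
infinitesimal boost identity), bounded by `tM` for `|r| ≤ |s|`, `t ≤ 1`; hence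
`|g_t(s) − g_t(0)| ≤ tM|s| → 0`, while `g_t(s) − g_t(0) → T(F ∘ B(−s)) − T(F)`. [cite: OsterwalderSchraderCMP1973, §4.2 eqs. (4.14)–(4.17)] -/
theorem _root_.Literature.MathematicalPhysics.QuantumFieldTheory.HasTimeRayBoundaryValue.apply_eq_of_boost_of_hasCompactSupport
    (hE1 : S.IsEuclideanCovariant) (hc : ContinuousOn 𝔚 (timeTube d n))
    (hh : IsTimeHolomorphicOn 𝔚 (timeTube d n))
    (hS : ∀ F : 𝓢((Fin n → EuclideanSpace ℝ (Fin (d + 1))), ℂ), IsTimeOrdered F →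
      S n F = ∫ x, 𝔚 (euclideanPoint x) * F x)
    (hT : HasTimeRayBoundaryValue 𝔚 T) (j : Fin d) (s : ℝ) {F G : 𝓢((Fin n → SpaceTime d), ℂ)}
    (hFc : HasCompactSupport (F : (Fin n → SpaceTime d) → ℂ))
    (hG : ∀ x, G x = F fun k => (boost j s).symm (x k)) : T G = T F := by
  have hG' : ∀ x, G x = F fun k => boost j (-s) (x k) := fun x => by
    simp only [hG, boost_symm_apply]
  have hF : ContDiff ℝ ∞ (F : (Fin n → SpaceTime d) → ℂ) := F.smooth ⊤
  have hFd : Differentiable ℝ (F : (Fin n → SpaceTime d) → ℂ) := hF.differentiable (by simp)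
  set η : Fin n → SpaceTime d := fun k => (((k : ℕ) : ℝ) + 1) • e₀ d with hη_def
  have hη : η ∈ temporalCone d n := stdDirection_mem_temporalCone
  have hIt : ∀ {t : ℝ}, 0 < t → 0 < ((t : ℂ) * I).im := fun ht => by simpa using ht
  have hVc : ∀ {t : ℝ}, 0 < t → Continuous fun x : Fin n → SpaceTime d => 𝔚 (rayC x η ((t : ℂ) * I)) :=
    fun ht => continuous_comp_rayC_of_continuousOn_timeTube hc hη (hIt ht)
  -- the boosted test functions
  have hFr : ∀ r : ℝ, ContDiff ℝ ∞ fun x : Fin n → SpaceTime d => F fun k => boost j (-r) (x k) := by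
    intro r
    have h1 : ContDiff ℝ ∞ fun x : Fin n → SpaceTime d => ((r, x) : ℝ × (Fin n → SpaceTime d)) :=
      contDiff_const.prodMk contDiff_id
    have h2 := hF.comp ((contDiff_boost_neg_diag (n := n) j).comp h1)
    exact h2
  have hFrc : ∀ r : ℝ, HasCompactSupport fun x : Fin n → SpaceTime d => F fun k => boost j (-r) (x k) :=
    fun r => hFc.comp_homeomorph (lorentzDiag n (boost j (-r))).toHomeomorph
  -- the uniform bound
  obtain ⟨M, hM⟩ := exists_bound_integral_rayC_mul_boostDeriv hc hh hT hη j hF hFc |s|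
  -- the regularised pairings and their derivatives
  have hderiv : ∀ {t : ℝ}, 0 < t → ∀ r : ℝ,
      HasDerivAt (fun r : ℝ => ∫ x, 𝔚 (rayC x η ((t : ℂ) * I)) * F (fun k => boost j (-r) (x k)))
        (((t : ℂ) * I) * ∫ x, 𝔚 (rayC x η ((t : ℂ) * I)) *
          ∑ k, ((η k 0 : ℝ) : ℂ) * fderiv ℝ (fun x : Fin n → SpaceTime d => F fun k => boost j (-r) (x k)) x
            (Pi.single k (EuclideanSpace.single j.succ (1 : ℝ)))) r := by
    intro t ht r
    have h1 := hasDerivAt_integral_mul_comp_boost_neg j (hVc ht) hF hFc r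
    refine h1.congr_deriv ?_
    have h2 := integral_rayC_mul_fderiv_boostGen hE1 hc hh hS j hη ht (hFr r) (hFrc r)
    simp only [fderiv_comp_boost_neg_diag_boostGen j r hFd] at h2
    rw [← neg_neg (((t : ℂ) * I) * _), ← h2, ← integral_neg]
    congr 1
    funext x
    rw [map_neg, mul_neg]
  -- the mean value inequality on `[-|s|, |s|]`
  have hmv : ∀ {t : ℝ}, t ∈ Ioc (0 : ℝ) 1 →
      ‖(∫ x, 𝔚 (rayC x η ((t : ℂ) * I)) * F (fun k => boost j (-s) (x k))) -
        ∫ x, 𝔚 (rayC x η ((t : ℂ) * I)) * F (fun k => boost j (-0) (x k))‖ ≤ t * M * ‖s - 0‖ := by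
    intro t ht
    refine (convex_Icc (-|s|) |s|).norm_image_sub_le_of_norm_hasDerivWithin_le
      (fun r _ => (hderiv ht.1 r).hasDerivWithinAt) (fun r hr => ?_)
      ⟨by simp, by simp⟩ ⟨neg_abs_le s, le_abs_self s⟩
    rw [norm_mul, Complex.norm_mul, Complex.norm_real, Complex.norm_I, mul_one, Real.norm_eq_abs,
      abs_of_pos ht.1]
    exact mul_le_mul_of_nonneg_left (hM t ht r (abs_le.2 hr)) ht.1.le
  -- the limits `t → 0⁺`
  have hlimG : Tendsto (fun t : ℝ => ∫ x, 𝔚 (rayC x η ((t : ℂ) * I)) * F (fun k => boost j (-s) (x k)))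
      (𝓝[>] 0) (𝓝 (T G)) := by
    have h := hT η hη G
    simp only [hG', ← rayC_mul_I] at h
    exact h
  have hlimF : Tendsto (fun t : ℝ => ∫ x, 𝔚 (rayC x η ((t : ℂ) * I)) * F (fun k => boost j (-0) (x k)))
      (𝓝[>] 0) (𝓝 (T F)) := by
    have h := hT η hη F
    simp only [← rayC_mul_I] at h
    simpa only [neg_zero, boost_zero_apply'] using h
  have hdiff := hlimG.sub hlimF
  have hzero : Tendsto (fun t : ℝ => (∫ x, 𝔚 (rayC x η ((t : ℂ) * I)) * F (fun k => boost j (-s) (x k))) -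
      ∫ x, 𝔚 (rayC x η ((t : ℂ) * I)) * F (fun k => boost j (-0) (x k))) (𝓝[>] 0) (𝓝 0) := by
    rw [tendsto_zero_iff_norm_tendsto_zero]
    have hbound : Tendsto (fun t : ℝ => t * M * ‖s - 0‖) (𝓝[>] 0) (𝓝 0) := by
      have : Tendsto (fun t : ℝ => t * M * ‖s - 0‖) (𝓝 0) (𝓝 (0 * M * ‖s - 0‖)) :=
        ((continuous_id.mul continuous_const).mul continuous_const).tendsto 0
      simpa using this.mono_left nhdsWithin_le_nhds
    refine squeeze_zero' (Eventually.of_forall fun t => norm_nonneg _) ?_ hbound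
    have hmem : ∀ᶠ t : ℝ in 𝓝[>] 0, t ∈ Ioc (0 : ℝ) 1 := by
      rw [eventually_nhdsWithin_iff]
      filter_upwards [Iio_mem_nhds one_pos] with t ht1 ht0
      exact ⟨ht0, le_of_lt ht1⟩
    filter_upwards [hmem] with t ht
    exact hmv ht
  have := tendsto_nhds_unique hdiff hzero
  exact sub_eq_zero.1 this

/-- **Boost invariance of the time-ray boundary value** (Osterwalder–Schrader I (1973), §4.2):
`T(F ∘ B_j(s)⁻¹) = T(F)` for every Schwartz `F` (witness form) — from the compactly supported case
by density of compact cutoffs in `𝓢`. [cite: OsterwalderSchraderCMP1973, §4.2] -/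
theorem _root_.Literature.MathematicalPhysics.QuantumFieldTheory.HasTimeRayBoundaryValue.apply_eq_of_boost
    (hE1 : S.IsEuclideanCovariant) (hc : ContinuousOn 𝔚 (timeTube d n))
    (hh : IsTimeHolomorphicOn 𝔚 (timeTube d n))
    (hS : ∀ F : 𝓢((Fin n → EuclideanSpace ℝ (Fin (d + 1))), ℂ), IsTimeOrdered F →
      S n F = ∫ x, 𝔚 (euclideanPoint x) * F x)
    (hT : HasTimeRayBoundaryValue 𝔚 T) (j : Fin d) (s : ℝ) {F G : 𝓢((Fin n → SpaceTime d), ℂ)}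
    (hG : ∀ x, G x = F fun k => (boost j s).symm (x k)) : T G = T F := by
  let Lc : 𝓢((Fin n → SpaceTime d), ℂ) →L[ℂ] 𝓢((Fin n → SpaceTime d), ℂ) :=
    SchwartzMap.compCLMOfContinuousLinearEquiv ℂ (lorentzDiag n (boost j s).symm)
  have hLc : ∀ (H : 𝓢((Fin n → SpaceTime d), ℂ)) (x : Fin n → SpaceTime d),
      Lc H x = H fun k => (boost j s).symm (x k) := fun H x => rfl
  have hGL : G = Lc F := by
    ext x
    rw [hG, hLc]
  obtain ⟨u, hu, hlim⟩ := exists_tsupport_subset_inter_closedBall_tendsto F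
  have huc : ∀ m, HasCompactSupport (u m : (Fin n → SpaceTime d) → ℂ) := fun m =>
    HasCompactSupport.of_support_subset_isCompact (isCompact_closedBall _ _)
      ((subset_tsupport _).trans ((hu m).trans inter_subset_right))
  have hm : ∀ m, T (Lc (u m)) = T (u m) := fun m =>
    hT.apply_eq_of_boost_of_hasCompactSupport hE1 hc hh hS j s (huc m) (hLc (u m))
  have h1 : Tendsto (fun m => T (Lc (u m))) atTop (𝓝 (T (Lc F))) :=
    ((T.continuous.comp Lc.continuous).tendsto F).comp hlim
  have h2 : Tendsto (fun m => T (u m)) atTop (𝓝 (T F)) := (T.continuous.tendsto F).comp hlim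
  simp only [hm] at h1
  rw [hGL]
  exact tendsto_nhds_unique h1 h2

/-! ### Assembly: invariance under the restricted Lorentz group -/

/-- The inverse of a product acts by the inverses in the opposite order. [folklore] -/
theorem continuousLinearEquiv_symm_mul_apply (Λ₁ Λ₂ : SpaceTime d ≃L[ℝ] SpaceTime d) (y : SpaceTime d) :
    (Λ₁ * Λ₂).symm y = Λ₂.symm (Λ₁.symm y) := by
  apply (Λ₁ * Λ₂).injective
  rw [ContinuousLinearEquiv.apply_symm_apply, continuousLinearEquiv_mul_apply,
    ContinuousLinearEquiv.apply_symm_apply, ContinuousLinearEquiv.apply_symm_apply]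

/-- **Invariance of a distribution (witness form) is closed under products.** [folklore] -/
theorem apply_eq_of_mul {Λ₁ Λ₂ : SpaceTime d ≃L[ℝ] SpaceTime d}
    (h₁ : ∀ F G : 𝓢((Fin n → SpaceTime d), ℂ), (∀ x, G x = F fun k => Λ₁.symm (x k)) → T G = T F)
    (h₂ : ∀ F G : 𝓢((Fin n → SpaceTime d), ℂ), (∀ x, G x = F fun k => Λ₂.symm (x k)) → T G = T F)
    (F G : 𝓢((Fin n → SpaceTime d), ℂ)) (hG : ∀ x, G x = F fun k => (Λ₁ * Λ₂).symm (x k)) :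
    T G = T F := by
  let H : 𝓢((Fin n → SpaceTime d), ℂ) :=
    SchwartzMap.compCLMOfContinuousLinearEquiv ℂ (lorentzDiag n Λ₂.symm) F
  have hH : ∀ x, H x = F fun k => Λ₂.symm (x k) := fun x => rfl
  have hG' : ∀ x, G x = H fun k => Λ₁.symm (x k) := fun x => by
    rw [hG, hH]
    simp only [continuousLinearEquiv_symm_mul_apply]
  rw [h₁ H G hG', h₂ F H hH]

/-- **(B) `OS1973_lorentzInvariant_of_timeContinuation` holds**: Osterwalder–Schrader I (1973),
§4.2 — the time-ray boundary value of an OS time continuation is invariant under the restricted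
Lorentz group, from E1 (spatial isometries: `OSTimeTubeRotations`; boosts: the infinitesimal
argument exponentiated above; generation: `exists_eq_spatialRotation_mul_boost_mul`). The OS
growth and spectral-support hypotheses of the fact are not used. [cite: OsterwalderSchraderCMP1973, §4.2 eqs. (4.14)–(4.17)] -/
theorem OS1973_lorentzInvariant_of_timeContinuation_holds : OS1973_lorentzInvariant_of_timeContinuation := by
  intro d _ n S 𝔚 T hE1 hc hh _ hT _ hS Λ hΛ F G hG
  obtain ⟨hΛL, hΛo, -⟩ := (mem_restrictedLorentzGroup_iff Λ).1 hΛ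
  obtain ⟨R₁, R₂, χ, rfl⟩ := exists_eq_spatialRotation_mul_boost_mul hΛL hΛo
    (⟨0, Nat.pos_of_ne_zero (NeZero.ne d)⟩ : Fin d)
  have hR : ∀ R : EuclideanSpace ℝ (Fin d) ≃ₗᵢ[ℝ] EuclideanSpace ℝ (Fin d),
      ∀ F G : 𝓢((Fin n → SpaceTime d), ℂ),
        (∀ x, G x = F fun k => (spatialRotation R.toContinuousLinearEquiv).symm (x k)) → T G = T F :=
    fun R F G hG => hT.apply_eq_of_spatialRotation hE1 hc hh hS R hG
  have hB : ∀ F G : 𝓢((Fin n → SpaceTime d), ℂ),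
      (∀ x, G x = F fun k => (boost (⟨0, Nat.pos_of_ne_zero (NeZero.ne d)⟩ : Fin d) χ).symm (x k)) →
        T G = T F :=
    fun F G hG => hT.apply_eq_of_boost hE1 hc hh hS _ χ hG
  exact apply_eq_of_mul (apply_eq_of_mul (hR R₁) hB) (hR R₂) F G hG

/-! ### Corollaries: the OS analytic core from (A1) alone -/

/-- **(A₁₂⁺) from (A1) alone**, (A2), (B), (D) being theorems. Real proof. [cite: OsterwalderSchraderCMP1975, §IV.2 pp. 288–289] -/
theorem OS1975_exists_continuation_halfSpace_of_A1 (hA1 : OS1975_exists_timeContinuation) :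
    OS1975_exists_continuation_halfSpace :=
  OS1975_exists_continuation_halfSpace_of_timeContinuation hA1
    OS1975_boundaryValue_of_timeContinuation_holds OS1973_lorentzInvariant_of_timeContinuation_holds
    eqOn_timeTube_of_timeRayBoundaryValue_holds

/-- **The spectral condition (R5) `OS1973_spectralCondition` from (A1) alone.** Real proof. [cite: OsterwalderSchraderCMP1975, §IV.2 pp. 288–289] -/
theorem OS1973_spectralCondition_of_A1 (hA1 : OS1975_exists_timeContinuation) :
    OS1973_spectralCondition :=
  OS1973_spectralCondition_of_halfSpace (OS1975_exists_continuation_halfSpace_of_A1 hA1)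

end Literature.MathematicalPhysics.QuantumFieldTheory
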